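import Summits.ABC.IUTFork.Cor312TeamAHonestCensus
import HarnessLib

/-!
# [IUTchIII] Cor. 3.12 — G-LOCALISED at NODE granularity under the honest reading: nineteen nodes outright, (xi-f) ⟺ the gap

Record-only, proof-only companion (D-0012) of `Cor312TeamAHonestCensus.lean` (p418084, abc-iut-w4-d021; wording of
record w5-d204 P1/O1, w5-d216 W2: the end-to-end census factors through the gap — the content of the census is
WHICH NODES hold). This file states that content node by node for c312-2's twenty-node chain
(`Cor312Proof.Step`, [IUTchIII] Cor. 3.12 proof pp. 174–186 [cite: Mochizuki2012, III Cor 3.12 pp.174–186]; claim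
key DISPUTED, D-0012), under the ONE fixed contentful reading `Cor312Proof.honestReading P C D L A` of p418084:

* `holds_honest_of_ne_xi_f` — EVERY node `s ≠ xi_f` HOLDS, from the node-side inputs only (Team B's four Step (x)
  real discharges, the strip-isomorphism slot, `ThetaFinite`, `|log(q)| > 0`) — NO gap hypothesis anywhere;
* `xi_f_holds_honest_iff` — node (xi-f) holds under the honest reading IFF `A.GapGlobal` (given `ThetaFinite ∧
  AbsLogQPos`, under which (xi-e)'s two outputs are theorems); with `InputStrip.gapGlobal_iff_statement`, IFF the
  Corollary's own `Statement`;
* `honest_chain_iff_gapGlobal` — hence the whole chain holds under the honest reading IFF the gap.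

So, in the kernel and over the frozen definitions: «every inference of the printed proof other than (xi-f) is
discharged; the inference at (xi-f), typed at the frozen interface, is exactly the Corollary's inequality»
(plan/ADJUDICATION-SPEC §2 (G1″), G-LOCALISED) — now as three theorems about the individual nodes of the printed
proof rather than about an assembled implication. TAKES NO SIDE; typed ≠ proved.
-/

namespace Summit.ABC

namespace IUTFork

namespace Cor312Proof

open Locus Obs Thm311 Cor312 Cor312Vol StepXI Literature.IUT.LogThetaLattice

variable {T : ThetaIndex} {S : Situation T} {P : Cor312.Setting S}

/-- **Nineteen of the twenty nodes hold OUTRIGHT under the honest reading** ([IUTchIII] Cor. 3.12 proof, opening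
paragraph + Steps (i)–(xi-e), (xi-g), (xi-h), (xii)): for every `s ≠ xi_f`, `s.Holds L (honestReading P C D L A)` from
the node-side inputs alone — per node exactly the lemma `teamA_chain` uses, with every wire the identity; no
hypothesis mentions the gap. [claim: Mochizuki2012, status: disputed] -/
theorem holds_honest_of_ne_xi_f (C : Column S.L) (D : ThetaLinkStrips P.LogLink P.Strip) (L : Locus → Prop)
    (A : InputStrip.StripAlgorithm P)
    (hIndAdm : ∀ Φ ∈ S.L.Ind1Family ∪ S.L.Ind2Family, ∀ (j : T.Label) (vQ : T.VQ)
      (X : Set (S.L.Packet j vQ)), (S.D P.n).Adm j vQ X ↔ (S.D P.n).Adm j vQ (Φ j vQ '' X))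
    (hIndVol : (S.D P.n).LogvolInvariant)
    (hMono : ∀ (j : T.Label) (vQ : T.VQ) (X Y : Set (S.L.Packet j vQ)),
      (S.D P.n).Adm j vQ X → (S.D P.n).Adm j vQ Y → X ⊆ Y →
        (S.D P.n).logvol j vQ X ≤ (S.D P.n).logvol j vQ Y)
    (hKumA : C.KummerA (S.D P.n))
    (hNE : ∀ n m : ℤ, Nonempty (P.IsoS (D.stripLGP (P.lattice.logLink n (m - 1)))
      (D.stripDelta (P.lattice.theater (n + 1) m))))
    (hfin : P.ThetaFinite) (hq : P.AbsLogQPos)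
    (s : Step) (hs : s ≠ .xi_f) : s.Holds L (honestReading P C D L A) := by
  cases s
  case wlog => exact wlog_holds_of trivial
  case i => exact i_holds_of trivial (PreX.linkGluing_nonempty P)
  case ii => exact ii_holds_of trivial trivial
  case iii => exact iii_holds_of trivial
  case iv => exact iv_holds_of fun _ => trivial
  case v => exact v_holds_of fun _ => ⟨trivial, trivial⟩
  case vi => exact vi_holds_of fun _ => ⟨trivial, trivial, trivial⟩
  case vii => exact vii_holds_of fun _ => ⟨trivial, trivial⟩
  case viii => exact viii_holds_of fun _ => trivial
  case ix => exact ix_holds_of fun _ _ => trivial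
  case x =>
    exact stepX_holds P C (fun _ _ => hIndAdm) (fun _ _ _ => hIndVol) (fun _ => hMono) (fun _ => hKumA)
      (fun h => h) (fun h => h) (fun h => h) (fun h => h)
  case xi_a => exact stepXIa_holds P D (VG := Nonempty (LinkGluing P)) (fun h => h) hNE (fun h => h)
  case xi_b =>
    exact stepXIb_holds P D (CIPL := L .IPL) (CSHE := L .SHE) (fun h => h) (fun h => h) (fun h => h)
      (fun h => h) (fun h => h)
  case xi_c => exact stepXIc_holds P D (CIPL := L .IPL) (CSHE := L .SHE) (fun h => h) (fun h => h) (fun h => h)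
  case xi_d => exact Cor312.Setting.stepXId_holds_of (agreesXIde_honestReading C D L A) hfin hq L
  case xi_e => exact Cor312.Setting.stepXIe_holds (agreesXIde_honestReading C D L A) L
  case xi_f => exact absurd rfl hs
  case xi_g => exact xi_g_holds_iff.2 fun _ _ => A.out_qIn
  case xi_h => exact xi_h_holds_of nthPower_not_formal
  case xii => exact xii_holds_of trivial

/-- **Node (xi-f) under the honest reading holds IFF the gap** (p. 184 l. 19–29): by `xi_f_holds_iff` the node is the
implication "(xi-e)'s outputs ⟹ `constitutesConstruction`", i.e. here `DisplayXIeReal → SheMeansFixedValueReal →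
A.GapGlobal`, and both antecedents are theorems under `ThetaFinite ∧ AbsLogQPos` (`gapSlot_iff_gapGlobal`).
[claim: Mochizuki2012, status: disputed] -/
theorem xi_f_holds_honest_iff (C : Column S.L) (D : ThetaLinkStrips P.LogLink P.Strip) (L : Locus → Prop)
    (A : InputStrip.StripAlgorithm P) (hfin : P.ThetaFinite) (hq : P.AbsLogQPos) :
    Step.xi_f.Holds L (honestReading P C D L A) ↔ A.GapGlobal :=
  xi_f_holds_iff.trans (gapSlot_iff_gapGlobal A hfin hq)

/-- … equivalently IFF the Corollary's own `Statement` (skel XXV/XXVb `InputStrip.gapGlobal_iff_statement`): at the frozen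
interface the one open node IS the conclusion — G-LOCALISED at node granularity. [claim: Mochizuki2012, status: disputed] -/
theorem xi_f_holds_honest_iff_statement (C : Column S.L) (D : ThetaLinkStrips P.LogLink P.Strip)
    (L : Locus → Prop) (A : InputStrip.StripAlgorithm P) (hfin : P.ThetaFinite) (hq : P.AbsLogQPos) :
    Step.xi_f.Holds L (honestReading P C D L A) ↔ P.Statement :=
  (xi_f_holds_honest_iff C D L A hfin hq).trans (InputStrip.gapGlobal_iff_statement A hfin)

/-- **The whole twenty-node chain under the honest reading holds IFF the gap** (given the node-side inputs).
[claim: Mochizuki2012, status: disputed] -/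
theorem honest_chain_iff_gapGlobal (C : Column S.L) (D : ThetaLinkStrips P.LogLink P.Strip) (L : Locus → Prop)
    (A : InputStrip.StripAlgorithm P)
    (hIndAdm : ∀ Φ ∈ S.L.Ind1Family ∪ S.L.Ind2Family, ∀ (j : T.Label) (vQ : T.VQ)
      (X : Set (S.L.Packet j vQ)), (S.D P.n).Adm j vQ X ↔ (S.D P.n).Adm j vQ (Φ j vQ '' X))
    (hIndVol : (S.D P.n).LogvolInvariant)
    (hMono : ∀ (j : T.Label) (vQ : T.VQ) (X Y : Set (S.L.Packet j vQ)),
      (S.D P.n).Adm j vQ X → (S.D P.n).Adm j vQ Y → X ⊆ Y →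
        (S.D P.n).logvol j vQ X ≤ (S.D P.n).logvol j vQ Y)
    (hKumA : C.KummerA (S.D P.n))
    (hNE : ∀ n m : ℤ, Nonempty (P.IsoS (D.stripLGP (P.lattice.logLink n (m - 1)))
      (D.stripDelta (P.lattice.theater (n + 1) m))))
    (hfin : P.ThetaFinite) (hq : P.AbsLogQPos) :
    Chain L (honestReading P C D L A) ↔ A.GapGlobal :=
  ⟨fun h => (xi_f_holds_honest_iff C D L A hfin hq).mp (h .xi_f),
    fun hg s => by
      by_cases hs : s = .xi_f
      · subst hs; exact (xi_f_holds_honest_iff C D L A hfin hq).mpr hg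
      · exact holds_honest_of_ne_xi_f C D L A hIndAdm hIndVol hMono hKumA hNE hfin hq s hs⟩

end Cor312Proof

end IUTFork

end Summit.ABC
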